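import Summits.QuantumFields.GaugeBoot.Rows.GLYZc2D4HTab
import HarnessLib

/-!
# Gauge-boot: kernel check of the raw `H` class table of the glyz-c2-4D problems, rows 141–160 (part 10/20)

Cell `pub-gaugeboot` (HOME `run/shared/lean/pub/pub-gaugeboot/`), seat lean1 (torus layer for rows C76–C87 = the certified
glyz-c2-4D windows: label set, raw blocks, class/witness tables, the reduction identity, per-β bindings).

HONEST FRAMING (page 1 of every file of this cell): certified bounds on lattice expectations at STATED coupling,
gauge group, dimension and torus size; NOT a mass gap, NOT a continuum limit, NOT a string tension, NOT large `N`.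
The venture is explicitly NOT Yang–Mills-summit-bearing (barriers `FixedCouplingUltralocality`,
`PerturbativeInvisibility`).

`hcanon_rows_<lo>_<hi> : ∀ i, lo ≤ i < hi → ∀ j ≥ i, GLYZc2D4.HCanonOK i j`, each range one closed computation (`decide +kernel`);
assembled in `GLYZc2D4Canon`.
-/

noncomputable section

open Literature.MathematicalPhysics.QuantumFieldTheory

namespace Summit.QuantumFields.GaugeBoot

namespace GLYZc2D4

set_option maxHeartbeats 0 in
/-- Rows `141 ≤ i < 145` of the `H` class table of the glyz-c2-4D problems canonicalise (1426 entries; kernel). -/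
theorem hcanon_rows_141_145 : ∀ i : Fin 499, 141 ≤ i.val → i.val < 145 → ∀ j : Fin 499, i.val ≤ j.val → GLYZc2D4.HCanonOK i j := by
  decide +kernel

set_option maxHeartbeats 0 in
/-- Rows `145 ≤ i < 149` of the `H` class table of the glyz-c2-4D problems canonicalise (1410 entries; kernel). -/
theorem hcanon_rows_145_149 : ∀ i : Fin 499, 145 ≤ i.val → i.val < 149 → ∀ j : Fin 499, i.val ≤ j.val → GLYZc2D4.HCanonOK i j := by
  decide +kernel

set_option maxHeartbeats 0 in
/-- Rows `149 ≤ i < 153` of the `H` class table of the glyz-c2-4D problems canonicalise (1394 entries; kernel). -/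
theorem hcanon_rows_149_153 : ∀ i : Fin 499, 149 ≤ i.val → i.val < 153 → ∀ j : Fin 499, i.val ≤ j.val → GLYZc2D4.HCanonOK i j := by
  decide +kernel

set_option maxHeartbeats 0 in
/-- Rows `153 ≤ i < 157` of the `H` class table of the glyz-c2-4D problems canonicalise (1378 entries; kernel). -/
theorem hcanon_rows_153_157 : ∀ i : Fin 499, 153 ≤ i.val → i.val < 157 → ∀ j : Fin 499, i.val ≤ j.val → GLYZc2D4.HCanonOK i j := by
  decide +kernel

set_option maxHeartbeats 0 in
/-- Rows `157 ≤ i < 161` of the `H` class table of the glyz-c2-4D problems canonicalise (1362 entries; kernel). -/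
theorem hcanon_rows_157_161 : ∀ i : Fin 499, 157 ≤ i.val → i.val < 161 → ∀ j : Fin 499, i.val ≤ j.val → GLYZc2D4.HCanonOK i j := by
  decide +kernel

end GLYZc2D4

end Summit.QuantumFields.GaugeBoot

end
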